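import Literature.AlgebraicGeometry.Resolution.QuasiRegularSequences
import Literature.AlgebraicGeometry.Resolution.MarkedIdealsLemmas
import Literature.AlgebraicGeometry.Resolution.EtaleVanishingIdeal
import Mathlib.RingTheory.Ideal.MinimalPrime.Basic
import Mathlib.RingTheory.Localization.Ideal
import Mathlib.RingTheory.Localization.AtPrime.Basic
import Mathlib.RingTheory.Regular.RegularSequence
import HarnessLib

/-!
# Symbolic = ordinary powers for radical ideals generated by a regular sequence; order ≥ μ along a complete-intersection closed set forces `J ⊆ 𝓘^μ`

Topic: `Literature/AlgebraicGeometry/Resolution`. Companion of `SymbolicPowersRegularQuotient.lean` (the case of a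
prime `P` with REGULAR quotient, Cossart–Piltant's brick) and of `QuasiRegularSequences.lean` (Rees' theorem,
Matsumura Thm. 16.2): here the centre is only assumed to be a (local) COMPLETE INTERSECTION — its ideal is
RADICAL and generated by a (weakly) regular sequence — with no regularity, Cohen–Macaulayness or irreducibility
of the centre and no Noetherian/regularity hypothesis on the ambient ring.

* RING LEVEL (`R` any commutative ring, `I = (x_1,…,x_k)` with `x` quasi-regular — e.g. a weakly regular
  sequence, `isQuasiRegular_of_isWeaklyRegular` — and `I` radical):
  `IsQuasiRegular.mem_pow_of_forall_minimalPrimes` — **`⋂_{P ∈ Min(I)} (Iⁿ R_P ∩ R) = Iⁿ`** («the powers of a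
  radical ideal generated by a regular sequence are unmixed»; Hochster's criterion / Zariski–Samuel II App. 6 in
  the form the proof of Matsumura 16.2 gives it): if for every minimal prime `P` of `I` some `s ∉ P` has
  `s·f ∈ Iⁿ`, then `f ∈ Iⁿ`. Proof (Rees form): if `f ∈ I^ν ∖ I^{ν+1}` then `f = F(x)` for a `ν`-form `F` with
  a coefficient `c ∉ I = ⋂ Min(I)`; at a minimal `P ∌ c`, `(sF)(x) = s f ∈ I^{ν+1}` puts all coefficients of `sF`
  in `I ⊆ P`, so `c ∈ P` — contradiction.
  `maximalIdeal_le_map_of_mem_minimalPrimes` — for `I` radical and `P ∈ Min(I)`: `P R_P ⊆ I R_P` (so `= 𝔪_{R_P}`).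
* SCHEME LEVEL (`X` any scheme, `Y ⊆ X` closed whose radical ideal sheaf `𝓘_Y` (Mathlib `vanishingIdeal`) is at
  every point of `Y` generated by a WEAKLY REGULAR sequence of `𝒪_{X,x}` — Mathlib `RingTheory.Sequence.IsWeaklyRegular`,
  e.g. `IsRegular`; stalks of `𝓘_Y` are radical: tree `isRadical_stalkIdeal_vanishingIdeal`):
  **`le_vanishingIdeal_pow_of_forall_le_idealOrder_of_isWeaklyRegular`**: if `ord_y J ≥ μ` at every point `y`
  of `Y` then `J ⊆ 𝓘_Y^μ` — the generalisation of `PermissibleLSB.le_vanishingIdeal_pow_of_forall_le_idealOrder`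
  from REGULAR centres to complete intersections (the generic points of the components of `Y` through `x` are
  reached by `exists_isLocalizationAtPrime_stalk`). This is the body of the W3.6 supply lemma «T-A»
  (`OrdPowAlong C` for everywhere-l.c.i. `C`) of the HIRONAKA campaign; see `Hironaka2017/Lib` for the `diffPower`
  corollary. Seat res-D-pv-025 (HIRONAKA-L).

## Sources

* H. Matsumura, *Commutative Ring Theory* (1986), Thm. 16.2 (Rees: regular ⇒ quasi-regular; `gr_I(A) ≅ (A/I)[X]`).
  [Matsumura1987]
* M. Hochster, *Criteria for equality of ordinary and symbolic powers of primes*, Math. Z. 133 (1973) 53–65 —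
  background for «c.i. ⇒ symbolic = ordinary» (not cited as a key).
* O. Zariski, P. Samuel, *Commutative Algebra* II (1960), Appendix 6. [ZariskiSamuel1960]
-/

noncomputable section

namespace Literature.AlgebraicGeometry.Resolution

universe u

open IsLocalRing MvPolynomial

/-! ## Ring level -/

section Ring

variable {R : Type u} [CommRing R]

/-- **Unmixedness of the powers of a radical ideal generated by a quasi-regular sequence**: let `x` be
quasi-regular (Matsumura §16; e.g. a weakly regular sequence, `isQuasiRegular_of_isWeaklyRegular`) with
`I = (x)` RADICAL. If for every minimal prime `P` of `I` there is `s ∉ P` with `s·f ∈ Iⁿ` (i.e. `f ∈ Iⁿ R_P ∩ R`),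
then `f ∈ Iⁿ`. Rees-form proof through `gr_I(R) ≅ (R/I)[X]`. [cite: Matsumura1987, Thm. 16.2] -/
theorem IsQuasiRegular.mem_pow_of_forall_minimalPrimes {k : ℕ} {x : Fin k → R} (hx : IsQuasiRegular x)
    (hrad : (Ideal.span (Set.range x)).IsRadical) {n : ℕ} {f : R}
    (h : ∀ P ∈ (Ideal.span (Set.range x)).minimalPrimes, ∃ s ∉ P, s * f ∈ Ideal.span (Set.range x) ^ n) :
    f ∈ Ideal.span (Set.range x) ^ n := by
  classical
  set I := Ideal.span (Set.range x) with hI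
  suffices key : ∀ ν : ℕ, ν ≤ n → f ∈ I ^ ν from key n le_rfl
  intro ν
  induction ν with
  | zero =>
    intro _
    rw [pow_zero, Ideal.one_eq_top]
    exact Submodule.mem_top
  | succ ν ih =>
    intro hν
    have hfν : f ∈ I ^ ν := ih (Nat.le_of_succ_le hν)
    obtain ⟨F, hF, hFf⟩ := exists_isHomogeneous_of_mem_span_pow x ν hfν
    -- every coefficient of `F` lies in every minimal prime of `I`, hence in `I = √I`
    have hcoef : F ∈ Ideal.map (C : R →+* MvPolynomial (Fin k) R) I := by
      rw [mem_map_C_iff]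
      intro m
      have hall : ∀ P ∈ I.minimalPrimes, F.coeff m ∈ P := by
        intro P hP
        haveI : P.IsPrime := hP.1.1
        obtain ⟨s, hs, hsf⟩ := h P hP
        have h1 : C s * F ∈ Ideal.map (C : R →+* MvPolynomial (Fin k) R) I :=
          hx ν (C s * F) (hF.C_mul s) (by
            rw [map_mul, eval_C, hFf]
            exact Ideal.pow_le_pow_right hν hsf)
        rw [mem_map_C_iff] at h1
        have h2 : s * F.coeff m ∈ P := hP.1.2 (by simpa only [coeff_C_mul] using h1 m)
        exact (Ideal.IsPrime.mem_or_mem ‹_› h2).resolve_left hs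
      have hmem : F.coeff m ∈ sInf I.minimalPrimes := by
        rw [Submodule.mem_sInf]
        exact hall
      rwa [Ideal.sInf_minimalPrimes, Ideal.radical_eq_iff.mpr hrad] at hmem
    have := eval_mem_mul_span_pow x hF hcoef
    rw [hFf, ← pow_succ'] at this
    exact this

/-- The same for a WEAKLY REGULAR sequence given as a list (Mathlib `RingTheory.Sequence.IsWeaklyRegular`,
`Ideal.ofList`): the powers of the radical ideal `I = (rs)` are unmixed — `f ∈ Iⁿ R_P ∩ R` for all minimal `P`
forces `f ∈ Iⁿ`. [cite: Matsumura1987, Thm. 16.2] -/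
theorem mem_pow_of_forall_minimalPrimes_of_isWeaklyRegular {rs : List R}
    (hreg : RingTheory.Sequence.IsWeaklyRegular R rs) (hrad : (Ideal.ofList rs).IsRadical) {n : ℕ} {f : R}
    (h : ∀ P ∈ (Ideal.ofList rs).minimalPrimes, ∃ s ∉ P, s * f ∈ Ideal.ofList rs ^ n) :
    f ∈ Ideal.ofList rs ^ n := by
  have hspan : Ideal.span (Set.range rs.get) = Ideal.ofList rs := by
    rw [Set.range_list_get]
  have hq : IsQuasiRegular rs.get :=
    isQuasiRegular_of_isWeaklyRegular rs.get (by rwa [List.ofFn_get])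
  rw [← hspan] at hrad h ⊢
  exact hq.mem_pow_of_forall_minimalPrimes hrad h

/-- **`P R_P ⊆ I R_P` (hence `I R_P = 𝔪_{R_P}`) for a RADICAL ideal `I` and a minimal prime `P` of `I`**: the
localisation of a radical ideal is radical (`IsLocalization.map_radical`) and `P R_P` is the only prime of `R_P`
over `I R_P`. [cite: Matsumura1987, §4 (localisation and primes), Thm. 4.1] -/
theorem maximalIdeal_le_map_of_mem_minimalPrimes {I P : Ideal R} (hrad : I.IsRadical)
    (hP : P ∈ I.minimalPrimes) (S : Type*) [CommRing S] [Algebra R S] [hPp : P.IsPrime]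
    [IsLocalization.AtPrime S P] [IsLocalRing S] :
    maximalIdeal S ≤ I.map (algebraMap R S) := by
  -- `I S` is radical
  have hradS : (I.map (algebraMap R S)).radical = I.map (algebraMap R S) := by
    rw [← IsLocalization.map_radical P.primeCompl S I, Ideal.radical_eq_iff.mpr hrad]
  rw [← hradS, Ideal.radical_eq_sInf, ← IsLocalization.AtPrime.map_eq_maximalIdeal P S]
  refine le_sInf fun Q hQ => ?_
  haveI : Q.IsPrime := hQ.2
  -- `Q ∩ R` is a prime over `I` inside `P`, hence `= P` by minimality
  have hQI : I ≤ Q.comap (algebraMap R S) := Ideal.map_le_iff_le_comap.mp hQ.1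
  have hQP : Q.comap (algebraMap R S) ≤ P := fun r hr => by
    by_contra hrP
    exact (Ideal.IsPrime.ne_top ‹Q.IsPrime›)
      (Ideal.eq_top_of_isUnit_mem _ (Ideal.mem_comap.mp hr)
        (IsLocalization.map_units S (⟨r, show r ∈ P.primeCompl from hrP⟩ : P.primeCompl)))
  have hPQ : P ≤ Q.comap (algebraMap R S) := hP.2 ⟨Ideal.IsPrime.comap _, hQI⟩ hQP
  exact (Ideal.map_mono hPQ).trans Ideal.map_comap_le

/-- **Contraction**: for `I` radical, `P ∈ Min(I)`, `S = R_P`: if `f/1 ∈ 𝔪_Sⁿ` then `s·f ∈ Iⁿ` for some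
`s ∉ P`. [cite: Matsumura1987, Thm. 4.1 (ideals in a localisation)] -/
theorem exists_mul_mem_pow_of_algebraMap_mem_pow {I P : Ideal R} (hrad : I.IsRadical)
    (hP : P ∈ I.minimalPrimes) (S : Type*) [CommRing S] [Algebra R S] [hPp : P.IsPrime]
    [IsLocalization.AtPrime S P] [IsLocalRing S] {n : ℕ} {f : R}
    (hf : algebraMap R S f ∈ maximalIdeal S ^ n) : ∃ s ∉ P, s * f ∈ I ^ n := by
  have h1 : algebraMap R S f ∈ (I ^ n).map (algebraMap R S) := by
    rw [Ideal.map_pow]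
    exact Ideal.pow_right_mono (maximalIdeal_le_map_of_mem_minimalPrimes hrad hP S) n hf
  obtain ⟨m, hm, hmf⟩ := (IsLocalization.algebraMap_mem_map_algebraMap_iff P.primeCompl S (I ^ n) f).mp h1
  exact ⟨m, hm, hmf⟩

end Ring

/-! ## Scheme level -/

section Scheme

open _root_.CategoryTheory _root_.AlgebraicGeometry _root_.TopologicalSpace
open _root_.AlgebraicGeometry.Scheme.IdealSheafData

variable {X : Scheme.{u}}

/-- **Order `≥ μ` along a complete-intersection closed set forces `J ⊆ 𝓘_Y^μ`.** Let `Y ⊆ X` be closed such that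
at every point `x ∈ Y` the stalk `(𝓘_Y)_x` of its radical ideal sheaf is generated by a WEAKLY REGULAR sequence of
`𝒪_{X,x}` (`Y` is locally a complete intersection in `X`; no regularity of `X` or `Y`, no irreducibility). If an ideal
sheaf `J` has `ord_y J ≥ μ` at EVERY point `y` of `Y`, then `J ⊆ 𝓘_Y^μ`. (At `x ∈ Y`: for each minimal prime `P` of
`(𝓘_Y)_x` the point `y` of `P` lies in `Y` with `𝒪_{X,y} = (𝒪_{X,x})_P` and `(𝓘_Y)_y = 𝔪_y`, so `ord_y J ≥ μ` reads
`J_x ⊆ (𝓘_Y)_x^μ 𝒪_{X,y} ∩ 𝒪_{X,x}`; unmixedness of the powers then gives `J_x ⊆ (𝓘_Y)_x^μ`.) Generalises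
`PermissibleLSB.le_vanishingIdeal_pow_of_forall_le_idealOrder` (regular centres).
[cite: Matsumura1987, Thm. 16.2] [cite: CossartPiltant2008, proof of Prop. 4.2] -/
theorem le_vanishingIdeal_pow_of_forall_le_idealOrder_of_isWeaklyRegular {Y : Closeds X}
    (hci : ∀ x ∈ (Y : Set X), ∃ rs : List (X.presheaf.stalk x),
      RingTheory.Sequence.IsWeaklyRegular (X.presheaf.stalk x) rs ∧
        Ideal.ofList rs = stalkIdeal (vanishingIdeal Y) x)
    {J : X.IdealSheafData} {μ : ℕ} (hY : ∀ y ∈ (Y : Set X), (μ : ℕ∞) ≤ idealOrder J y) :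
    J ≤ vanishingIdeal Y ^ μ := by
  refine le_of_forall_stalkIdeal_le fun x => ?_
  rw [stalkIdeal_pow]
  by_cases hx : x ∈ (vanishingIdeal Y).support
  swap
  · rw [stalkIdeal_eq_top_of_not_mem_support hx, Ideal.top_pow]
    exact le_top
  have hxY : x ∈ (Y : Set X) := by
    rw [← coe_support_vanishingIdeal Y]
    exact hx
  obtain ⟨rs, hreg, hI⟩ := hci x hxY
  have hrad : (Ideal.ofList rs).IsRadical := by
    rw [hI]
    exact isRadical_stalkIdeal_vanishingIdeal Y x
  intro f hf
  rw [← hI]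
  refine mem_pow_of_forall_minimalPrimes_of_isWeaklyRegular hreg hrad fun P hP => ?_
  haveI : P.IsPrime := hP.1.1
  -- the point `y` of the minimal prime `P`
  obtain ⟨y, φ, hloc, hst⟩ := exists_isLocalizationAtPrime_stalk x P
  letI := φ.toAlgebra
  haveI : IsLocalization.AtPrime (X.presheaf.stalk y) P := hloc
  have hIy : stalkIdeal (vanishingIdeal Y) y = (Ideal.ofList rs).map (algebraMap _ (X.presheaf.stalk y)) := by
    rw [hst, hI, RingHom.algebraMap_toAlgebra]
  -- `y ∈ Y` since `(𝓘_Y)_y ⊆ P 𝒪_{X,y} = 𝔪_y`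
  have hy : y ∈ (Y : Set X) := by
    rw [← coe_support_vanishingIdeal Y]
    refine (mem_support_iff_stalkIdeal_le _ y).mpr ?_
    rw [hIy, ← IsLocalization.AtPrime.map_eq_maximalIdeal P (X.presheaf.stalk y)]
    exact Ideal.map_mono hP.1.2
  have hJy : stalkIdeal J y ≤ maximalIdeal (X.presheaf.stalk y) ^ μ :=
    (le_idealOrder_iff J y μ).mp (hY y hy)
  have hfy : algebraMap _ (X.presheaf.stalk y) f ∈ maximalIdeal (X.presheaf.stalk y) ^ μ := by
    refine hJy ?_
    rw [hst J, RingHom.algebraMap_toAlgebra]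
    exact Ideal.mem_map_of_mem φ hf
  exact exists_mul_mem_pow_of_algebraMap_mem_pow hrad hP (X.presheaf.stalk y) hfy

/-- The same with Mathlib's `IsRegular` sequences (weakly regular + proper), the hypothesis shape of the HIRONAKA
campaign's «A-type cut» `IsLCICutAt`. [cite: Matsumura1987, Thm. 16.2] -/
theorem le_vanishingIdeal_pow_of_forall_le_idealOrder_of_isRegular {Y : Closeds X}
    (hci : ∀ x ∈ (Y : Set X), ∃ rs : List (X.presheaf.stalk x),
      RingTheory.Sequence.IsRegular (X.presheaf.stalk x) rs ∧
        Ideal.ofList rs = stalkIdeal (vanishingIdeal Y) x)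
    {J : X.IdealSheafData} {μ : ℕ} (hY : ∀ y ∈ (Y : Set X), (μ : ℕ∞) ≤ idealOrder J y) :
    J ≤ vanishingIdeal Y ^ μ :=
  le_vanishingIdeal_pow_of_forall_le_idealOrder_of_isWeaklyRegular
    (fun x hx => let ⟨rs, h, e⟩ := hci x hx; ⟨rs, h.toIsWeaklyRegular, e⟩) hY

/-- **Pointwise form** (for MIXED classes): at a point `x` where `(𝓘_Y)_x` is generated by a WEAKLY REGULAR sequence of `𝒪_{X,x}`
(no hypothesis at the other points of `Y`), every ideal sheaf `J` with `ord_y J ≥ μ` at every point `y ∈ Y` satisfies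
`J_x ⊆ (𝓘_Y)_x^μ`. (Only the generic points of the components of `Y` through `x` are used.) The global statement
`le_vanishingIdeal_pow_of_forall_le_idealOrder_of_isWeaklyRegular` is this at every point; the pointwise form is what a
local-to-global argument on a closed set that is l.c.i. only on part of itself needs.
[cite: Matsumura1987, Thm. 16.2] [cite: CossartPiltant2008, proof of Prop. 4.2] -/
theorem stalkIdeal_le_stalkIdeal_vanishingIdeal_pow_of_isWeaklyRegular {Y : Closeds X} {x : X}
    (hci : ∃ rs : List (X.presheaf.stalk x),
      RingTheory.Sequence.IsWeaklyRegular (X.presheaf.stalk x) rs ∧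
        Ideal.ofList rs = stalkIdeal (vanishingIdeal Y) x)
    {J : X.IdealSheafData} {μ : ℕ} (hY : ∀ y ∈ (Y : Set X), (μ : ℕ∞) ≤ idealOrder J y) :
    stalkIdeal J x ≤ stalkIdeal (vanishingIdeal Y) x ^ μ := by
  obtain ⟨rs, hreg, hI⟩ := hci
  have hrad : (Ideal.ofList rs).IsRadical := by
    rw [hI]
    exact isRadical_stalkIdeal_vanishingIdeal Y x
  intro f hf
  rw [← hI]
  refine mem_pow_of_forall_minimalPrimes_of_isWeaklyRegular hreg hrad fun P hP => ?_
  haveI : P.IsPrime := hP.1.1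
  obtain ⟨y, φ, hloc, hst⟩ := exists_isLocalizationAtPrime_stalk x P
  letI := φ.toAlgebra
  haveI : IsLocalization.AtPrime (X.presheaf.stalk y) P := hloc
  have hIy : stalkIdeal (vanishingIdeal Y) y = (Ideal.ofList rs).map (algebraMap _ (X.presheaf.stalk y)) := by
    rw [hst, hI, RingHom.algebraMap_toAlgebra]
  have hy : y ∈ (Y : Set X) := by
    rw [← coe_support_vanishingIdeal Y]
    refine (mem_support_iff_stalkIdeal_le _ y).mpr ?_
    rw [hIy, ← IsLocalization.AtPrime.map_eq_maximalIdeal P (X.presheaf.stalk y)]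
    exact Ideal.map_mono hP.1.2
  have hJy : stalkIdeal J y ≤ maximalIdeal (X.presheaf.stalk y) ^ μ :=
    (le_idealOrder_iff J y μ).mp (hY y hy)
  have hfy : algebraMap _ (X.presheaf.stalk y) f ∈ maximalIdeal (X.presheaf.stalk y) ^ μ := by
    refine hJy ?_
    rw [hst J, RingHom.algebraMap_toAlgebra]
    exact Ideal.mem_map_of_mem φ hf
  exact exists_mul_mem_pow_of_algebraMap_mem_pow hrad hP (X.presheaf.stalk y) hfy

/-- Pointwise form with Mathlib's `IsRegular` generators (the «A-type at the point `x`» hypothesis of the HIRONAKA campaign).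
[cite: Matsumura1987, Thm. 16.2] -/
theorem stalkIdeal_le_stalkIdeal_vanishingIdeal_pow_of_isRegular {Y : Closeds X} {x : X}
    (hci : ∃ rs : List (X.presheaf.stalk x),
      RingTheory.Sequence.IsRegular (X.presheaf.stalk x) rs ∧
        Ideal.ofList rs = stalkIdeal (vanishingIdeal Y) x)
    {J : X.IdealSheafData} {μ : ℕ} (hY : ∀ y ∈ (Y : Set X), (μ : ℕ∞) ≤ idealOrder J y) :
    stalkIdeal J x ≤ stalkIdeal (vanishingIdeal Y) x ^ μ :=
  let ⟨rs, h, e⟩ := hci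
  stalkIdeal_le_stalkIdeal_vanishingIdeal_pow_of_isWeaklyRegular ⟨rs, h.toIsWeaklyRegular, e⟩ hY

end Scheme

end Literature.AlgebraicGeometry.Resolution

end
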